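import Summits.Ventures.Crystal3D.Theorems.StickyWulffConstantCoaxialWallLawPayerEndPairsMultiRootNm
import Summits.Ventures.Crystal3D.Theorems.StickyWulffConstantCoaxialWallLawPayerTransCellPlaneExport
import Summits.Ventures.Crystal3D.Theorems.StickyWulffConstantCoaxialWallLawEndRowDefs
import Summits.Ventures.Crystal3D.Theorems.StickyWulffConstantCoaxialWallLawWordPlane
import Summits.Ventures.Crystal3D.Theorems.StickyWulffConstantCoaxialWallLawSources
import Summits.Ventures.Crystal3D.Theorems.StickyWulffConstantCoaxialWallLawBandCount
import HarnessLib

/-!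
# End accounting, multi-source VI″: the PLANE-COSET translation cell's pooled END PAIRS with well-formed chains and the
# NON-MOVING clause

HONEST FRAMING. Venture `Summits/Ventures/Crystal3D` (cell `crystal3d-full`), helper for the crux `CoaxialWallLaw`
(stmt-Ventures-19481, line `WallLedgerF`, stub `stub_coaxialTwoSlabAdhesion`).  Rung credit only; F-C1 not moved.  STEP-2 of
cf-p1 (xxxiii), 19481-p2 g6: `wordNet_trans_endPairs_plane_multi` (`…PayerTransCellPlaneExport`: frame `G₀`, any root set
`RT` of rising slots with skew partners `sk`) VERBATIM, fed by `word_endPairs_multiExcl_invRoot_nm`, exporting per pair also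
`WFChain r κ` (`…EndRowDefs`) and the non-moving clause of the target state — what the census row `LocalEndRow` counts.
* `wordNet_trans_endPairs_plane_multi_nm`.  WHAT THIS IS NOT: the stub; the top pull-back / two-plate row cell are next;
F-C1 not moved.
-/
noncomputable section

namespace Summit.Ventures.Crystal3D.Theorems

open Summit.Ventures.Crystal3D Finset
open Literature.MathematicalPhysics.StatisticalMechanics (fccStacking)
open scoped InnerProductSpace

open scoped Classical in
/-- **The plane-coset translation cell's pooled end pairs (any root family with skew partners), exported.**  See the
module docstring. -/
theorem wordNet_trans_endPairs_plane_multi_nm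
    {δ : ℝ} (hg : KissingGap δ) (hc : KissingClassification δ)
    (G₀ : EuclideanSpace ℝ (Fin 3) ≃ₗᵢ[ℝ] EuclideanSpace ℝ (Fin 3))
    {F : List (EuclideanSpace ℝ (Fin 3)) → (EuclideanSpace ℝ (Fin 3) ≃ₗᵢ[ℝ] EuclideanSpace ℝ (Fin 3))}
    (hF0 : F [] = G₀) (hFc : ∀ μ κ, F (μ :: κ) = ((ℝ ∙ μ)ᗮ.reflection).trans (F κ))
    (RT : Finset (EuclideanSpace ℝ (Fin 3))) (hRT : ∀ r ∈ RT, r ∈ fccSlots ∧ 0 < (G₀ r) 2)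
    (sk : EuclideanSpace ℝ (Fin 3) → EuclideanSpace ℝ (Fin 3))
    (s₁ s₂ : EuclideanSpace ℝ (Fin 3))
    (hsk : ∀ r ∈ RT, sk r ∈ fccSlots ∧ ⟪r, sk r⟫_ℝ = 0 ∧ ∀ z : ℤ, ⟪G₀.symm (s₂ - s₁), sk r⟫_ℝ ≠ (z : ℝ) / 2)
    (X P₁ P₂ : Finset (EuclideanSpace ℝ (Fin 3))) (R₀ h ρ : ℝ)
    (hR₀ : 10 ≤ R₀) (hh : 0 ≤ h) (hρ : R₀ ≤ ρ)
    (hX : ∀ p ∈ X, ∀ q ∈ X, p ≠ q → 1 ≤ dist p q)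
    (hcell : ∀ p ∈ X, -(2 * R₀) ≤ p 2 ∧ p 2 ≤ h + 2 * R₀ ∧ p 0 ^ 2 + p 1 ^ 2 ≤ ρ ^ 2)
    (hP₁X : P₁ ⊆ X) (hP₂X : P₂ ⊆ X)
    (hP₁ : ∀ p, p ∈ P₁ ↔ (p ∈ (fun q => G₀ q + s₁) '' fccStacking 1 (Real.sqrt (2 / 3)) ∧
      -(2 * R₀) ≤ p 2 ∧ p 2 ≤ -R₀ ∧ p 0 ^ 2 + p 1 ^ 2 ≤ ρ ^ 2))
    (hP₂ : ∀ p, p ∈ P₂ ↔ (p ∈ (fun q => G₀ q + s₂) '' fccStacking 1 (Real.sqrt (2 / 3)) ∧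
      h + R₀ ≤ p 2 ∧ p 2 ≤ h + 2 * R₀ ∧ p 0 ^ 2 + p 1 ^ 2 ≤ ρ ^ 2)) :
    ∃ T : Finset (EuclideanSpace ℝ (Fin 3) × EuclideanSpace ℝ (Fin 3)),
      Real.sqrt 2 * (∑ r ∈ RT, (G₀ r) 2) * Real.pi * ρ ^ 2 -
          12 * (12 * Real.sqrt 2 * Real.pi + 36 * R₀ + 55440) * ρ ≤ (T.card : ℝ) ∧
      (∀ bq ∈ T, bq.1 ∈ X ∧ bq.2 ∈ X ∧ dist bq.1 bq.2 = 1 ∧ -R₀ - 1 ≤ bq.1 2 ∧ bq.1 2 < h + R₀ + 1) ∧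
      (∀ bq ∈ T, (X.filter fun q => dist bq.1 q = 1).card ≤ 11 ∨
        ∃ z₁ ∈ X, ∃ z₂ ∈ X, z₁ ≠ z₂ ∧ dist bq.1 z₁ = 1 ∧ dist bq.1 z₂ = 1 ∧
          (X.filter fun q => dist z₁ q = 1).card ≤ 11 ∧ (X.filter fun q => dist z₂ q = 1).card ≤ 11) ∧
      (∀ bq ∈ T, ∃ r ∈ RT, (∃ z : ℤ, ⟪G₀.symm (bq.1 - s₁), sk r⟫_ℝ = (z : ℝ) / 2) ∧
        ∃ (κ : List (EuclideanSpace ℝ (Fin 3))) (d : EuclideanSpace ℝ (Fin 3)), WFChain r κ ∧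
        (∀ μ ∈ κ, ‖μ‖ = 1 ∧
          ∀ w ∈ fccSlots, ⟪w, μ⟫_ℝ = 0 ∨ ⟪w, μ⟫_ℝ = Real.sqrt (2 / 3) ∨ ⟪w, μ⟫_ℝ = -Real.sqrt (2 / 3)) ∧
        List.IsChain (fun μ μ' => ⟪μ, μ'⟫_ℝ = 1 / 3 ∨ ⟪μ, μ'⟫_ℝ = -1 / 3) κ ∧
        d = F κ (((-1 : ℝ) ^ κ.length) • r) ∧
        (((∀ w ∈ fccSlots, bq.2 + F κ w ∈ X) ∧ bq.1 = bq.2 + d ∧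
            ¬ ((∀ w ∈ fccSlots, bq.1 + F κ w ∈ X) ∨
              ∃ m' : EuclideanSpace ℝ (Fin 3), ‖m'‖ = 1 ∧
                (∀ w ∈ fccSlots, ⟪F κ w, m'⟫_ℝ = 0 ∨ ⟪F κ w, m'⟫_ℝ = Real.sqrt (2 / 3) ∨ ⟪F κ w, m'⟫_ℝ = -Real.sqrt (2 / 3)) ∧
                (∀ w ∈ fccSlots, ⟪F κ w, m'⟫_ℝ ≤ 0 → bq.1 + F κ w ∈ X) ∧
                (∀ w ∈ fccSlots, ⟪F κ w, m'⟫_ℝ < 0 → bq.1 + (F κ w - (2 * ⟪F κ w, m'⟫_ℝ) • m') ∈ X) ∧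
                (∀ w ∈ fccSlots, 0 < ⟪F κ w, m'⟫_ℝ → bq.1 + F κ w ∉ X) ∧
                (⟪d, m'⟫_ℝ = Real.sqrt (2 / 3) ∨ ⟪d, m'⟫_ℝ = 0))) ∨
          ∃ m : EuclideanSpace ℝ (Fin 3), ‖m‖ = 1 ∧
            (∀ w ∈ fccSlots, ⟪F κ w, m⟫_ℝ = 0 ∨ ⟪F κ w, m⟫_ℝ = Real.sqrt (2 / 3) ∨ ⟪F κ w, m⟫_ℝ = -Real.sqrt (2 / 3)) ∧
            (∀ w ∈ fccSlots, ⟪F κ w, m⟫_ℝ ≤ 0 → bq.2 + F κ w ∈ X) ∧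
            (∀ w ∈ fccSlots, ⟪F κ w, m⟫_ℝ < 0 → bq.2 + (F κ w - (2 * ⟪F κ w, m⟫_ℝ) • m) ∈ X) ∧
            (∀ w ∈ fccSlots, 0 < ⟪F κ w, m⟫_ℝ → bq.2 + F κ w ∉ X) ∧
            ((⟪d, m⟫_ℝ = Real.sqrt (2 / 3) ∧ bq.1 = bq.2 - (d - (2 * ⟪d, m⟫_ℝ) • m) ∧
              ¬ ((∀ w ∈ fccSlots, bq.1 + (F κ w - (2 * ⟪F κ w, m⟫_ℝ) • m) ∈ X) ∨
                ∃ m' : EuclideanSpace ℝ (Fin 3), ‖m'‖ = 1 ∧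
                  (∀ w ∈ fccSlots, ⟪F κ w - (2 * ⟪F κ w, m⟫_ℝ) • m, m'⟫_ℝ = 0 ∨
                    ⟪F κ w - (2 * ⟪F κ w, m⟫_ℝ) • m, m'⟫_ℝ = Real.sqrt (2 / 3) ∨
                    ⟪F κ w - (2 * ⟪F κ w, m⟫_ℝ) • m, m'⟫_ℝ = -Real.sqrt (2 / 3)) ∧
                  (∀ w ∈ fccSlots, ⟪F κ w - (2 * ⟪F κ w, m⟫_ℝ) • m, m'⟫_ℝ ≤ 0 →
                    bq.1 + (F κ w - (2 * ⟪F κ w, m⟫_ℝ) • m) ∈ X) ∧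
                  (∀ w ∈ fccSlots, ⟪F κ w - (2 * ⟪F κ w, m⟫_ℝ) • m, m'⟫_ℝ < 0 →
                    bq.1 + ((F κ w - (2 * ⟪F κ w, m⟫_ℝ) • m) - (2 * ⟪F κ w - (2 * ⟪F κ w, m⟫_ℝ) • m, m'⟫_ℝ) • m') ∈ X) ∧
                  (∀ w ∈ fccSlots, 0 < ⟪F κ w - (2 * ⟪F κ w, m⟫_ℝ) • m, m'⟫_ℝ →
                    bq.1 + (F κ w - (2 * ⟪F κ w, m⟫_ℝ) • m) ∉ X) ∧
                  (⟪-(d - (2 * ⟪d, m⟫_ℝ) • m), m'⟫_ℝ = Real.sqrt (2 / 3) ∨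
                    ⟪-(d - (2 * ⟪d, m⟫_ℝ) • m), m'⟫_ℝ = 0))) ∨
              (⟪d, m⟫_ℝ = 0 ∧ bq.1 = bq.2 + d ∧
              ¬ ((∀ w ∈ fccSlots, bq.1 + F κ w ∈ X) ∨
                ∃ m' : EuclideanSpace ℝ (Fin 3), ‖m'‖ = 1 ∧
                  (∀ w ∈ fccSlots, ⟪F κ w, m'⟫_ℝ = 0 ∨ ⟪F κ w, m'⟫_ℝ = Real.sqrt (2 / 3) ∨ ⟪F κ w, m'⟫_ℝ = -Real.sqrt (2 / 3)) ∧
                  (∀ w ∈ fccSlots, ⟪F κ w, m'⟫_ℝ ≤ 0 → bq.1 + F κ w ∈ X) ∧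
                  (∀ w ∈ fccSlots, ⟪F κ w, m'⟫_ℝ < 0 → bq.1 + (F κ w - (2 * ⟪F κ w, m'⟫_ℝ) • m') ∈ X) ∧
                  (∀ w ∈ fccSlots, 0 < ⟪F κ w, m'⟫_ℝ → bq.1 + F κ w ∉ X) ∧
                  (⟪d, m'⟫_ℝ = Real.sqrt (2 / 3) ∨ ⟪d, m'⟫_ℝ = 0)))))) := by
  have hRTS : ∀ r ∈ RT, r ∈ fccSlots := fun r hr => (hRT r hr).1
  have hRTup : ∀ r ∈ RT, 0 < (G₀ r) 2 := fun r hr => (hRT r hr).2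
  have hRTcard : (RT.card : ℝ) ≤ 12 := by
    have : RT.card ≤ 12 := (card_le_card fun r hr => hRTS r hr).trans (by rw [card_fccSlots])
    exact_mod_cast this
  have hsq23 : 0 < Real.sqrt (2 / 3) := Real.sqrt_pos.2 (by norm_num)
  have hR₀3 : (3 : ℝ) ≤ R₀ := by linarith
  have hρ0 : (0 : ℝ) ≤ ρ := by linarith
  have hρ1 : (1 : ℝ) ≤ ρ := by linarith
  -- the word data over the bottom frame (the frame function `F` is given)
  set uw : EuclideanSpace ℝ (Fin 3) → List (EuclideanSpace ℝ (Fin 3)) → EuclideanSpace ℝ (Fin 3) :=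
    fun r κ => κ.foldr (fun _ v => -v) r with huw
  set WFw : EuclideanSpace ℝ (Fin 3) → List (EuclideanSpace ℝ (Fin 3)) → Prop := fun r κ =>
    List.rec (motive := fun _ => Prop) True (fun μ κ' ih => ih ∧ ‖μ‖ = 1 ∧
      (∀ w ∈ fccSlots, ⟪w, μ⟫_ℝ = 0 ∨ ⟪w, μ⟫_ℝ = Real.sqrt (2 / 3) ∨ ⟪w, μ⟫_ℝ = -Real.sqrt (2 / 3)) ∧
      ⟪uw r κ', μ⟫_ℝ = Real.sqrt (2 / 3) ∧ ∀ μ' κ'', κ' = μ' :: κ'' → μ' ≠ -μ) κ with hWFw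
  set nextw : List (EuclideanSpace ℝ (Fin 3)) → EuclideanSpace ℝ (Fin 3) → List (EuclideanSpace ℝ (Fin 3)) :=
    fun κ m => @ite _ (∃ μ κ', κ = μ :: κ' ∧ (F κ).symm m = -μ) (Classical.propDecidable _) κ.tail
      ((F κ).symm m :: κ) with hnextw
  have hu0 : ∀ r, uw r [] = r := fun _ => rfl
  have huc : ∀ r μ κ, uw r (μ :: κ) = -uw r κ := fun _ _ _ => rfl
  have hWF0 : ∀ r, WFw r [] := fun _ => trivial
  have hWFc : ∀ r μ κ, WFw r (μ :: κ) ↔ (WFw r κ ∧ ‖μ‖ = 1 ∧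
      (∀ w ∈ fccSlots, ⟪w, μ⟫_ℝ = 0 ∨ ⟪w, μ⟫_ℝ = Real.sqrt (2 / 3) ∨ ⟪w, μ⟫_ℝ = -Real.sqrt (2 / 3)) ∧
      ⟪uw r κ, μ⟫_ℝ = Real.sqrt (2 / 3) ∧ ∀ μ' κ', κ = μ' :: κ' → μ' ≠ -μ) := fun _ _ _ => Iff.rfl
  have hnext_pop : ∀ μ κ' (m : EuclideanSpace ℝ (Fin 3)), (F (μ :: κ')).symm m = -μ → nextw (μ :: κ') m = κ' := by
    intro μ κ' m hν
    simp only [hnextw]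
    rw [if_pos ⟨μ, κ', rfl, hν⟩, List.tail_cons]
  have hnext_push : ∀ κ (m : EuclideanSpace ℝ (Fin 3)), (∀ μ κ', κ = μ :: κ' → (F κ).symm m ≠ -μ) →
      nextw κ m = (F κ).symm m :: κ := by
    intro κ m hnp
    simp only [hnextw]
    rw [if_neg]
    rintro ⟨μ, κ', h, hν⟩
    exact hnp μ κ' h hν
  clear_value nextw WFw uw
  have hu : ∀ r ∈ RT, ∀ κ, uw r κ ∈ fccSlots := fun r hr => word_u_mem (hRTS r hr) (hu0 r) (huc r)
  have husign : ∀ (r : EuclideanSpace ℝ (Fin 3)) (κ : List (EuclideanSpace ℝ (Fin 3))), uw r κ = r ∨ uw r κ = -r := by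
    intro r κ
    induction κ with
    | nil => exact Or.inl (hu0 r)
    | cons μ κ ih =>
      rw [huc]
      rcases ih with h' | h'
      · exact Or.inr (by rw [h'])
      · exact Or.inl (by rw [h', neg_neg])
  -- THE ROOT-INDEXED PLANE INVARIANT: letters `⊥ sk r`, position pairing with `sk r` in `½ℤ`
  set Ps : EuclideanSpace ℝ (Fin 3) → EuclideanSpace ℝ (Fin 3) × List (EuclideanSpace ℝ (Fin 3)) → Prop :=
    fun r v => (∀ μ ∈ v.2, ⟪μ, sk r⟫_ℝ = 0) ∧ ∃ z : ℤ, ⟪(F []).symm (v.1 - s₁), sk r⟫_ℝ = (z : ℝ) / 2 with hPs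
  have hus' : ∀ r ∈ RT, ∀ κ : List (EuclideanSpace ℝ (Fin 3)), ⟪uw r κ, sk r⟫_ℝ = 0 := by
    intro r hr κ
    rcases husign r κ with h' | h'
    · rw [h']; exact (hsk r hr).2.1
    · rw [h', inner_neg_left, (hsk r hr).2.1, neg_zero]
  -- (i) letters: a pushed letter is oblique to `±r`, hence orthogonal to `sk r`
  have hnext_letters : ∀ r ∈ RT, ∀ (κ : List (EuclideanSpace ℝ (Fin 3))) (m : EuclideanSpace ℝ (Fin 3)),
      WFw r (nextw κ m) → (∀ μ ∈ κ, ⟪μ, sk r⟫_ℝ = 0) → ∀ μ ∈ nextw κ m, ⟪μ, sk r⟫_ℝ = 0 := by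
    intro r hr κ m hwf hκ μ hμ
    by_cases hpop : ∃ μ₀ κ', κ = μ₀ :: κ' ∧ (F κ).symm m = -μ₀
    · obtain ⟨μ₀, κ', hκeq, hν⟩ := hpop
      rw [hκeq] at hν hμ hκ
      rw [hnext_pop μ₀ κ' m hν] at hμ
      exact hκ μ (List.mem_cons_of_mem _ hμ)
    · push Not at hpop
      have hn : nextw κ m = (F κ).symm m :: κ := hnext_push κ m fun μ₀ κ' h' => hpop μ₀ κ' h'
      rw [hn] at hμ hwf
      rcases List.mem_cons.1 hμ with rfl | hμ
      · obtain ⟨-, hν1, hνmenu, hνu, -⟩ := (hWFc _ _ _).1 hwf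
        have hwν : ⟪uw r [], (F κ).symm m⟫_ℝ ≠ 0 := by
          rcases husign r κ with h' | h'
          · rw [hu0, ← h', hνu]; exact hsq23.ne'
          · have : ⟪r, (F κ).symm m⟫_ℝ = -Real.sqrt (2 / 3) := by
              have h'' := hνu; rw [h', inner_neg_left] at h''; linarith
            rw [hu0, this]; exact neg_ne_zero.2 hsq23.ne'
        exact menuNormal_inner_eq_zero_of_orth (hu r hr []) (hsk r hr).1 (hus' r hr []) hν1 hνmenu hwν
      · exact hκ μ hμ
  -- (ii) positions: a move along an `sk r`-orthogonal class keeps `⟪G₀⁻¹(b − s₁), sk r⟫`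
  have hmove : ∀ r ∈ RT, ∀ (b : EuclideanSpace ℝ (Fin 3)) (κ : List (EuclideanSpace ℝ (Fin 3))), WFw r κ →
      (∀ μ ∈ κ, ⟪μ, sk r⟫_ℝ = 0) →
      ⟪(F []).symm (b + F κ (uw r κ) - s₁), sk r⟫_ℝ = ⟪(F []).symm (b - s₁), sk r⟫_ℝ := by
    intro r hr b κ hwf hκ
    obtain ⟨hlet, -⟩ := word_letters_of_wf (huc r) (hWFc r) κ hwf
    have hκu : ∀ μ ∈ κ, ‖μ‖ = 1 := fun μ hμ => (hlet μ hμ).1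
    have e1 : F κ (uw r κ) =
        F [] (κ.foldl (fun (y : EuclideanSpace ℝ (Fin 3)) μ => y - (2 * ⟪y, μ⟫_ℝ) • μ) (uw r κ)) := by
      have := word_F_append_apply hFc κ hκu [] (uw r κ)
      rw [List.append_nil] at this
      exact this
    rw [show b + F κ (uw r κ) - s₁ = (b - s₁) + F κ (uw r κ) by abel, map_add, e1,
      LinearIsometryEquiv.symm_apply_apply, inner_add_left, inner_foldl_reflect_eq_of_orth (sk r) κ hκ, hus' r hr,
      add_zero]
  -- the inner sample
  set zcut : ℝ := h + R₀ + 1 with hzcut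
  set P' : Finset (EuclideanSpace ℝ (Fin 3)) := P₁.filter fun p =>
    -(2 * R₀) + 1 ≤ p 2 ∧ p 2 ≤ -R₀ - 1 ∧ p 0 ^ 2 + p 1 ^ 2 ≤ (ρ - 1) ^ 2 with hP'def
  have hP'iff : ∀ p, p ∈ P' ↔ (p ∈ (fun q => G₀ q + s₁) '' fccStacking 1 (Real.sqrt (2 / 3)) ∧
      -(2 * R₀) + 1 ≤ p 2 ∧ p 2 ≤ -R₀ - 1 ∧ p 0 ^ 2 + p 1 ^ 2 ≤ (ρ - 1) ^ 2) := by
    intro p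
    rw [hP'def, mem_filter, hP₁]
    constructor
    · rintro ⟨⟨hΛ, -, -, -⟩, h1, h2, h3⟩; exact ⟨hΛ, h1, h2, h3⟩
    · rintro ⟨hΛ, h1, h2, h3⟩
      have hρ1' : (0 : ℝ) ≤ ρ - 1 := by linarith
      exact ⟨⟨hΛ, by linarith, by linarith, by nlinarith⟩, h1, h2, h3⟩
  -- the inner sample has full shells (complete sample)
  have hP'full : ∀ p ∈ P', ∀ w ∈ fccSlots, p + F [] w ∈ X := by
    intro p hp w hw
    rw [hF0]
    obtain ⟨hΛ, h1, h2, h3⟩ := (hP'iff p).1 hp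
    apply hP₁X
    rw [hP₁]
    have hw2 : |(G₀ w) 2| ≤ 1 := by rw [apply_two_eq_inner_e₃]; exact abs_inner_slot_le_one G₀ hw
    obtain ⟨hw2a, hw2b⟩ := abs_le.1 hw2
    refine ⟨movedFcc_add_site_mem G₀ s₁ hΛ (mem_fcc_of_mem_fccSlots hw), ?_, ?_, ?_⟩
    · show -(2 * R₀) ≤ (p + G₀ w) 2
      rw [PiLp.add_apply]; linarith
    · show (p + G₀ w) 2 ≤ -R₀
      rw [PiLp.add_apply]; linarith
    · show (p + G₀ w) 0 ^ 2 + (p + G₀ w) 1 ^ 2 ≤ ρ ^ 2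
      have hρ1' : (0 : ℝ) ≤ ρ - 1 := by linarith
      have hsl : Real.sqrt (p 0 ^ 2 + p 1 ^ 2) ≤ ρ - 1 := by
        rw [← Real.sqrt_sq hρ1']; exact Real.sqrt_le_sqrt h3
      have e1 := sqrt_lateral_add_le p (G₀ w)
      rw [LinearIsometryEquiv.norm_map, norm_eq_one_of_mem_fccSlots hw] at e1
      have e3 : Real.sqrt ((p + G₀ w) 0 ^ 2 + (p + G₀ w) 1 ^ 2) ≤ ρ := by linarith
      have e4 := Real.sq_sqrt (by positivity : (0 : ℝ) ≤ (p + G₀ w) 0 ^ 2 + (p + G₀ w) 1 ^ 2)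
      have e5 : (0 : ℝ) ≤ Real.sqrt ((p + G₀ w) 0 ^ 2 + (p + G₀ w) 1 ^ 2) := Real.sqrt_nonneg _
      nlinarith
  have hP₁' : ∀ p, p ∈ P₁ ↔ (p ∈ (fun q => F [] q + s₁) '' fccStacking 1 (Real.sqrt (2 / 3)) ∧
      -(2 * R₀) ≤ p 2 ∧ p 2 ≤ -R₀ ∧ p 0 ^ 2 + p 1 ^ 2 ≤ ρ ^ 2) := by rw [hF0]; exact hP₁
  have hP'iff' : ∀ p, p ∈ P' ↔ (p ∈ (fun q => F [] q + s₁) '' fccStacking 1 (Real.sqrt (2 / 3)) ∧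
      -(2 * R₀) + 1 ≤ p 2 ∧ p 2 ≤ -R₀ - 1 ∧ p 0 ^ 2 + p 1 ^ 2 ≤ (ρ - 1) ^ 2) := by rw [hF0]; exact hP'iff
  have hP₂' : ∀ p, p ∈ P₂ ↔ (p ∈ (fun q => F [] q + s₂) '' fccStacking 1 (Real.sqrt (2 / 3)) ∧
      h + R₀ ≤ p 2 ∧ p 2 ≤ h + 2 * R₀ ∧ p 0 ^ 2 + p 1 ^ 2 ≤ ρ ^ 2) := by rw [hF0]; exact hP₂
  have hup : ∀ r ∈ RT, 0 < (F [] r) 2 := by intro r hr; rw [hF0]; exact hRTup r hr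
  -- (iii) the invariant along each family's automaton
  have hPsrc : ∀ r ∈ RT, ∀ p ∈ P', Ps r (p + F [] r, []) := by
    intro r hr p hp
    refine ⟨fun μ hμ => by simp at hμ, ?_⟩
    obtain ⟨⟨q, hq, hpq⟩, -, -, -⟩ := (hP'iff' p).1 hp
    obtain ⟨z, hz⟩ := inner_fcc_slot_half_int hq (hsk r hr).1
    refine ⟨z, ?_⟩
    show ⟪(F []).symm (p + F [] r - s₁), sk r⟫_ℝ = (z : ℝ) / 2
    have := hmove r hr p [] (hWF0 r) (fun μ hμ => by simp at hμ)
    rw [hu0] at this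
    rw [this, ← hpq, add_sub_cancel_right, LinearIsometryEquiv.symm_apply_apply, hz]
  have hPfull : ∀ r ∈ RT, ∀ (b : EuclideanSpace ℝ (Fin 3)) (κ : List (EuclideanSpace ℝ (Fin 3))), WFw r κ →
      Ps r (b, κ) → Ps r (b + F κ (uw r κ), κ) := by
    rintro r hr b κ hwf ⟨hκ, z, hz⟩
    exact ⟨hκ, z, by rw [hmove r hr b κ hwf hκ, hz]⟩
  have hPcross : ∀ r ∈ RT, ∀ (b : EuclideanSpace ℝ (Fin 3)) (κ : List (EuclideanSpace ℝ (Fin 3)))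
      (m : EuclideanSpace ℝ (Fin 3)),
      WFw r κ → WFw r (nextw κ m) → Ps r (b, κ) → Ps r (b + F (nextw κ m) (uw r (nextw κ m)), nextw κ m) := by
    rintro r hr b κ m - hwf' ⟨hκ, z, hz⟩
    have hκ' : ∀ μ ∈ nextw κ m, ⟪μ, sk r⟫_ℝ = 0 := hnext_letters r hr κ m hwf' hκ
    exact ⟨hκ', z, by rw [hmove r hr b (nextw κ m) hwf' hκ', hz]⟩
  have hPtop : ∀ r ∈ RT, ∀ (b : EuclideanSpace ℝ (Fin 3)) (κ : List (EuclideanSpace ℝ (Fin 3))),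
      WFw r κ → Ps r (b, κ) → b ∉ P₂ := by
    rintro r hr b κ - ⟨-, z, hz⟩ hbP
    obtain ⟨⟨q, hq, hpq⟩, -, -, -⟩ := (hP₂' b).1 hbP
    obtain ⟨z', hz'⟩ := inner_fcc_slot_half_int hq (hsk r hr).1
    have e : (F []).symm (b - s₁) = q + (F []).symm (s₂ - s₁) := by
      rw [← hpq, show F [] q + s₂ - s₁ = F [] q + (s₂ - s₁) by abel, map_add, LinearIsometryEquiv.symm_apply_apply]
    rw [e, inner_add_left, hz', hF0] at hz
    exact (hsk r hr).2.2 (z - z') (by push_cast; linarith)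
  -- (1) the multi-root NET count with the root-indexed invariant
  obtain ⟨T, hTkey, hTpair, hTpay, hTwit⟩ := word_endPairs_multiExcl_invRoot_nm (F := F) (u := uw) (WF := WFw)
    (next := nextw) (t₁ := s₁) (t₂ := s₂) (P := Ps) hg hc hX hFc RT hRTS (fun r _ => hu0 r) (fun r _ => huc r)
    (fun r _ => hWF0 r) (fun r _ => hWFc r) hnext_pop hnext_push (F []) hPfull hPcross
    (fun r hr b κ hκ hP hb _ _ => hPtop r hr b κ hκ hP hb) hup hR₀3 hρ hcell hP₁X hP₂X hP₁' hP'iff' hP'full hPsrc hP₂'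
  rw [hF0] at hTkey
  -- (2) the sources, per root
  have hsources : ∀ r ∈ RT, Real.sqrt 2 * (G₀ r) 2 * Real.pi * (ρ - 1) ^ 2 -
        10 * Real.sqrt 2 * Real.pi * (ρ - 1) - 36 * R₀ * ρ ≤
      ((P'.filter fun p => (∀ w ∈ fccSlots, p + G₀ w ∈ X) ∧
          -R₀ - 1 < (p + G₀ r) 2 ∧ (p + G₀ r) 2 < zcut).card : ℝ) := by
    intro r hr
    have key := card_vertical_tops_ge G₀ s₁ X P₁ P' R₀ ρ zcut hR₀3 hρ (by rw [hzcut]; linarith)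
      hX hP₁X hP₁ hP'iff (hRTS r hr) (by rw [← apply_two_eq_inner_e₃]; exact (hRTup r hr).le)
    rw [← apply_two_eq_inner_e₃, abs_of_pos (hRTup r hr)] at key
    exact key
  -- (3) the rims
  set RIMT := X.filter fun s => zcut ≤ s 2 ∧ s 2 ≤ zcut + 1 ∧ (ρ - 2) ^ 2 < s 0 ^ 2 + s 1 ^ 2 with hRIMT
  have hrimT : (RIMT.card : ℝ) ≤ 144 * ρ := by
    have hsep : ∀ p ∈ RIMT, ∀ q ∈ RIMT, p ≠ q → 1 ≤ dist p q :=
      fun p hp q hq hpq => hX p (mem_filter.1 hp).1 q (mem_filter.1 hq).1 hpq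
    have hmem : ∀ p ∈ RIMT, zcut ≤ p 2 ∧ p 2 ≤ zcut + 1 ∧ (ρ - 2) ^ 2 < p 0 ^ 2 + p 1 ^ 2 ∧
        p 0 ^ 2 + p 1 ^ 2 ≤ ρ ^ 2 := by
      intro p hp
      obtain ⟨hpX, h1, h2, h3⟩ := mem_filter.1 hp
      exact ⟨h1, h2, h3, (hcell p hpX).2.2⟩
    have key := card_mul_le_of_separated_in_shell RIMT hsep zcut (zcut + 1) (ρ - 2) ρ (by linarith)
      (by linarith) (by linarith) hmem
    have e : (zcut + 1 - zcut + 2) * (Real.pi * (ρ + 1) ^ 2 - Real.pi * (ρ - 2 - 1) ^ 2) =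
        (Real.pi / 6) * (144 * ρ - 144) := by ring
    rw [e] at key
    have hπ : 0 < Real.pi / 6 := by positivity
    have := le_of_mul_le_mul_right (by linarith [key] : (RIMT.card : ℝ) * (Real.pi / 6) ≤
      (144 * ρ - 144) * (Real.pi / 6)) hπ
    linarith
  set RIMB := X.filter fun s => -R₀ - 1 - 1 ≤ s 2 ∧ s 2 < -R₀ - 1 ∧ (ρ - 1) ^ 2 < s 0 ^ 2 + s 1 ^ 2 with hRIMB
  have hrimB : (RIMB.card : ℝ) ≤ 108 * ρ := by
    have hsep : ∀ p ∈ RIMB, ∀ q ∈ RIMB, p ≠ q → 1 ≤ dist p q :=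
      fun p hp q hq hpq => hX p (mem_filter.1 hp).1 q (mem_filter.1 hq).1 hpq
    have hmem : ∀ p ∈ RIMB, -R₀ - 1 - 1 ≤ p 2 ∧ p 2 ≤ -R₀ - 1 ∧ (ρ - 1) ^ 2 < p 0 ^ 2 + p 1 ^ 2 ∧
        p 0 ^ 2 + p 1 ^ 2 ≤ ρ ^ 2 := by
      intro p hp
      obtain ⟨hpX, h1, h2, h3⟩ := mem_filter.1 hp
      exact ⟨h1, h2.le, h3, (hcell p hpX).2.2⟩
    have key := card_mul_le_of_separated_in_shell RIMB hsep (-R₀ - 1 - 1) (-R₀ - 1) (ρ - 1) ρ (by linarith)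
      (by linarith) (by linarith) hmem
    have e : (-R₀ - 1 - (-R₀ - 1 - 1) + 2) * (Real.pi * (ρ + 1) ^ 2 - Real.pi * (ρ - 1 - 1) ^ 2) =
        (Real.pi / 6) * (108 * ρ - 54) := by ring
    rw [e] at key
    have hπ : 0 < Real.pi / 6 := by positivity
    have := le_of_mul_le_mul_right (by linarith [key] : (RIMB.card : ℝ) * (Real.pi / 6) ≤
      (108 * ρ - 54) * (Real.pi / 6)) hπ
    linarith
  -- (4) arithmetic
  have hcast : ((∑ r ∈ RT, (P'.filter fun p => (∀ w ∈ fccSlots, p + G₀ w ∈ X) ∧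
      -R₀ - 1 < (p + G₀ r) 2 ∧ (p + G₀ r) 2 < zcut).card : ℕ) : ℝ) ≤
      (T.card : ℝ) + (RT.card : ℝ) * (220 * (RIMT.card : ℝ) + 220 * (RIMB.card : ℝ)) := by
    have h0 : ∑ r ∈ RT, (P'.filter fun p => (∀ w ∈ fccSlots, p + G₀ w ∈ X) ∧
        -R₀ - 1 < (p + G₀ r) 2 ∧ (p + G₀ r) 2 < zcut).card ≤
        T.card + RT.card * (220 * RIMT.card + 220 * RIMB.card) := hTkey
    exact_mod_cast h0
  rw [Nat.cast_sum] at hcast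
  have h2 : 0 ≤ Real.sqrt 2 := Real.sqrt_nonneg _
  have hπ : 0 ≤ Real.pi := Real.pi_pos.le
  have h2π : 0 ≤ Real.sqrt 2 * Real.pi * ρ := mul_nonneg (mul_nonneg h2 hπ) hρ0
  have hper : ∀ r ∈ RT, Real.sqrt 2 * (G₀ r) 2 * Real.pi * ρ ^ 2 - (12 * Real.sqrt 2 * Real.pi + 36 * R₀) * ρ ≤
      ((P'.filter fun p => (∀ w ∈ fccSlots, p + G₀ w ∈ X) ∧
          -R₀ - 1 < (p + G₀ r) 2 ∧ (p + G₀ r) 2 < zcut).card : ℝ) := by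
    intro r hr
    have hs := hsources r hr
    set α := (G₀ r) 2 with hα
    have hα0 : 0 ≤ α := (hRTup r hr).le
    have hαle : α ≤ 1 := by
      have := abs_inner_slot_le_one G₀ (hRTS r hr)
      rw [← apply_two_eq_inner_e₃] at this
      exact (abs_le.1 this).2
    have hsq : Real.sqrt 2 * α * Real.pi * (ρ - 1) ^ 2 ≥ Real.sqrt 2 * α * Real.pi * ρ ^ 2 - 2 * Real.sqrt 2 * Real.pi * ρ := by
      have e : Real.sqrt 2 * α * Real.pi * (ρ - 1) ^ 2 = Real.sqrt 2 * α * Real.pi * ρ ^ 2 -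
          2 * Real.sqrt 2 * α * Real.pi * ρ + Real.sqrt 2 * α * Real.pi := by ring
      rw [e]
      have h1 : Real.sqrt 2 * α * Real.pi * ρ ≤ Real.sqrt 2 * Real.pi * ρ := by
        have := mul_le_mul_of_nonneg_left hαle h2π
        have e1 : Real.sqrt 2 * α * Real.pi * ρ = Real.sqrt 2 * Real.pi * ρ * α := by ring
        rw [mul_one] at this; rw [e1]; exact this
      have h3 : 0 ≤ Real.sqrt 2 * α * Real.pi := mul_nonneg (mul_nonneg h2 hα0) hπ
      linarith
    have h10 : 10 * Real.sqrt 2 * Real.pi * (ρ - 1) ≤ 10 * Real.sqrt 2 * Real.pi * ρ := by nlinarith only [h2π, h2, hπ]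
    linarith only [hs, hsq, h10, h2π]
  have hsum := sum_le_sum hper
  rw [sum_sub_distrib, sum_const, nsmul_eq_mul, ← sum_mul, ← sum_mul, ← mul_sum] at hsum
  have hK0 : 0 ≤ (12 * Real.sqrt 2 * Real.pi + 36 * R₀ + 55440) * ρ := by
    have : 0 ≤ 12 * Real.sqrt 2 * Real.pi + 36 * R₀ + 55440 := by positivity
    exact mul_nonneg this hρ0
  have hloss : (RT.card : ℝ) * ((12 * Real.sqrt 2 * Real.pi + 36 * R₀) * ρ) +
      (RT.card : ℝ) * (220 * (RIMT.card : ℝ) + 220 * (RIMB.card : ℝ)) ≤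
      12 * (12 * Real.sqrt 2 * Real.pi + 36 * R₀ + 55440) * ρ := by
    have hrims : 220 * (RIMT.card : ℝ) + 220 * (RIMB.card : ℝ) ≤ 55440 * ρ := by linarith [hrimT, hrimB]
    have hc0 : (0 : ℝ) ≤ RT.card := Nat.cast_nonneg _
    have h1 : (RT.card : ℝ) * ((12 * Real.sqrt 2 * Real.pi + 36 * R₀) * ρ) +
        (RT.card : ℝ) * (220 * (RIMT.card : ℝ) + 220 * (RIMB.card : ℝ)) ≤
        (RT.card : ℝ) * ((12 * Real.sqrt 2 * Real.pi + 36 * R₀ + 55440) * ρ) := by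
      have := mul_le_mul_of_nonneg_left hrims hc0
      nlinarith only [this]
    have h2 := mul_le_mul_of_nonneg_right hRTcard hK0
    linarith only [h1, h2]
  refine ⟨T, by linarith only [hcast, hsum, hloss], hTpair, hTpay, ?_⟩
  -- (5) the exported witnesses, in closed form
  intro bq hbq
  obtain ⟨r, hr, ⟨κ₀, -, -, z, hz⟩, κ, hκ, hpat⟩ := hTwit bq hbq
  refine ⟨r, hr, ⟨z, by rw [← hF0]; exact hz⟩, κ, F κ (uw r κ), ?_⟩
  obtain ⟨hlet, hch⟩ := word_letters_of_wf (huc r) (hWFc r) κ hκ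
  have hd : F κ (uw r κ) = F κ (((-1 : ℝ) ^ κ.length) • r) := by rw [word_u_eq_pow (huc r) κ, hu0 r]
  have hWFconv : ∀ κ' : List (EuclideanSpace ℝ (Fin 3)), WFw r κ' → WFChain r κ' := by
    intro κ'
    induction κ' with
    | nil => intro _; simp only [WFChain]
    | cons μ κ' ih =>
      intro hμ
      obtain ⟨hκ', h1, h2, h3, h4⟩ := (hWFc r μ κ').1 hμ
      rw [word_u_eq_pow (huc r) κ', hu0 r] at h3
      rw [WFChain]; exact ⟨ih hκ', h1, h2, h3, h4⟩
  exact ⟨hWFconv κ hκ, hlet, hch, hd, hpat⟩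

end Summit.Ventures.Crystal3D.Theorems

end
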